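import Summits.BirchSwinnertonDyer.BirchSwinnertonDyer.Theorems.EisensteinPrimesSplitMultCharImprimitiveShift
import HarnessLib

/-!
# Route `SchneiderFreeAdditiveX3` (K1 door), crux r3 `GordTwoBranchIMC` (stmt-BirchSwinnertonDyer-19177): THE IMPRIMITIVE → PRIMITIVE
# `λ`-SHIFT FOR THE RESIDUAL CHARACTERS AT ANY BAD EISENSTEIN PRIME `p ∣ N_W` — `λ(𝔛^{Sf}_nr(θ)) = λ(𝔛_nr(θ)) + Σ_{w∈Sf} λ𝒫_w(θ)` for
# `θ ∈ {θsub, θquot}`, `Sf` = places over `N_W` off `p` (Keller–Yin Prop. 1.2.5 (eq:Gr to imp) / CGLS Prop. 1.2.5, kernel modulo Greenberg's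
# five facts BY NAME) — x2-p2 g10's `SplitMultCharImprimitiveShift` with «split multiplicative» weakened to «`p ∣ N_W`» (ADDITIVE included)

Cell `bsd-schneider-ideate`, seat `bsd-schneider-door-c5` (prover, generation 31; assembly layer; `--supports` 19177, helper).
PARTITION: board row B6 ∩ X3 ∩ sst-twist, `r = 1` (7 101 pairs; every `W` there is ADDITIVE at `p`).  bears_on: K1-door (items 18971/18972 retired
→ 19177 r3).  FILE 10 of the anomalous-twin port (FINDING-door-c5-g28 §5b `stub_λW`): after `…AnomalousTwistLambdaLEOffP` the algebraic side reads
`λ(DSsub.X) + λ(DSquot.X) ≤ λ(𝔛^{Sf}(W_K)) + [θquot = 𝟙]` for the IMPRIMITIVE unramified duals over the door's `3`-free `Sf`; the character-level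
inputs of the door ([RH] `thm122_rubinHida_residualPair_unrSelmer`, [BR]) speak about PRIMITIVE duals.  The bridge is Keller–Yin Prop. 1.2.5
(eq:Gr to imp).  Cell bsd-eis proved it in the kernel modulo published facts for the good anomalous lattice (x1 LEAD g2's road (A)) and x2-p2 g10
ran it at a split multiplicative prime — using «split multiplicative» at ONE point only: `p ∣ N_W`, to identify `Sf ∪ {v, v̄}` with the places over
`N_W`.  THIS FILE is that file with the hypothesis weakened to `¬ W.HasGoodReductionAtPrime p` (`p ∣ N_W`,
`dvd_conductorNorm_iff_not_hasGoodReductionAtPrime`), so that it serves the door's ADDITIVE `W` (and still x2's split one):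
* §0 `conductorNorm_mem_of_natCast_mem_of_not_good`, `mem_insert_insert_iff_conductorNorm_mem_of_not_good`;
* §1 `sum_charLocalLambda_le_zpCorank_unrSelmer_quotient_of_not_good` — road (A)'s `≥`, GRANTED Greenberg 2016 Prop. 2.6.3, Greenberg 2006
  Props. 4.1, 4.2, §5 A, 3.2 BY NAME and [RH] for `θ` (every primitive dual datum f.g. torsion `μ = 0`);
* §2 `imprimitive_clauses_of_not_good` — the whole Prop. 1.2.5 package: every imprimitive dual datum `DS` over `Sf` is f.g. `Λ`-torsion with
  `μ = 0` AND `λ(DS.X) = λ(D.X) + Σ_{w∈Sf} λ𝒫_w(θ)` for every primitive `D`.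
Proof text: x2's, verbatim up to the two substitutions (credit: bsd-line-x2-p2 g10; x1 LEAD g2 road (A), x1-p1-w2 adapters).

HONEST FRAMING: helper theorems only (0 defs, 0 named facts introduced, 0 sorry); CONDITIONAL on the five named Greenberg facts (hypotheses,
already inputs of both cells' chains) and on the displayed [RH]-type clause; closes no stub; nothing analytic; no item closed; BSD proved for no
curve; «closes rung: none».  References: [KellerYin2024] Prop. 1.2.5 (eq:Gr to imp), Lemma 1.1.1, Rem. 1.2.3 (ii) (arXiv:2402.12781v2);
[CastellaGrossiLeeSkinner2022] Prop. 1.2.5; [Greenberg2016Selmer] Prop. 2.6.3; [Greenberg2006] Props. 3.2, 4.1, 4.2, §5 A; [PollackWeston2011]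
App. A Prop. A.2; [GreenbergVatsal2000] §2 Cor. (2.3), Prop. (2.4); [Brink2007] Thm. 2.
-/

set_option autoImplicit false
set_option linter.dupNamespace false

noncomputable section

open scoped Classical
open NumberField IsDedekindDomain Field Multiplicative PowerSeries WeierstrassCurve
open Literature.NumberTheory.EllipticCurves Literature.NumberTheory.EllipticCurves.GreenbergSelmer
  Literature.NumberTheory.EllipticCurves.GreenbergVatsal2000 Literature.NumberTheory.GaloisRepresentations
  Literature.NumberTheory.EllipticCurves.KellerYin2024 Literature.NumberTheory.EllipticCurves.IwasawaDual
  Literature.NumberTheory.IwasawaTheory Literature.NumberTheory.IwasawaTheory.Greenberg2016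
  Literature.NumberTheory.IwasawaTheory.Greenberg2006 Literature.NumberTheory.EllipticCurves.Castella2018
  Summit.BirchSwinnertonDyer.BirchSwinnertonDyer.Theorems
  Summit.BirchSwinnertonDyer.BirchSwinnertonDyer.Theorems.GreenbergFullAtSelmer
  Summit.BirchSwinnertonDyer.BirchSwinnertonDyer.Theorems.AcTwistDeformationResidualPair
  Summit.BirchSwinnertonDyer.BirchSwinnertonDyer.Theorems.UnrSelmerQuotientTorsionFiniteChar
  Summit.BirchSwinnertonDyer.BirchSwinnertonDyer.Theorems.AcTwistDeformation

namespace Summit.BirchSwinnertonDyer.BirchSwinnertonDyer.Theorems.SchneiderFreeAdditiveX3.BadPrimeCharImprimitiveShift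

/-! ## §0. `p ∣ N_W`: `Sf ∪ {v, v̄}` is the set of places over `N_W` -/

section Bookkeeping

variable {K : Type} [Field K] [NumberField K] {p : ℕ} [hp : Fact p.Prime]

omit [NumberField K] in
/-- `p ∣ N_W` at a BAD prime, read as `N_W ∈ w` for every place `w ∋ p` of `K`. [cite: SilvermanAEC2009, VII.§5 and VIII.§1] -/
theorem conductorNorm_mem_of_natCast_mem_of_not_good (W : WeierstrassCurve ℚ) [W.IsElliptic] [W.IsGloballyMinimal]
    (hbad : ¬ W.HasGoodReductionAtPrime p) {w : HeightOneSpectrum (𝓞 K)} (hw : ((p : ℕ) : 𝓞 K) ∈ w.asIdeal) :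
    ((W.conductorNorm ℤ : ℤ) : 𝓞 K) ∈ w.asIdeal := by
  obtain ⟨m, hm⟩ := (W.dvd_conductorNorm_iff_not_hasGoodReductionAtPrime p).mpr hbad
  rw [hm, Nat.cast_mul, Int.cast_mul, Int.cast_natCast]
  exact w.asIdeal.mul_mem_right _ hw

/-- **At a split multiplicative `p`, `Sf ∪ {v, v̄}` is the set of places over `N_W`** when `Sf` is line b1's imprimitivity set
(`w ∈ Sf ↔ (N_W ∈ w ∧ p ∉ w)`) and `v ≠ v̄` are the two places over `p` (`K` imaginary quadratic): the x1 producers' convention.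
[cite: KellerYin2024, §5.1 (arXiv:2402.12781v2 TeX L1725–1735)] -/
theorem mem_insert_insert_iff_conductorNorm_mem_of_not_good (W : WeierstrassCurve ℚ) [W.IsElliptic] [W.IsGloballyMinimal]
    (hbad : ¬ W.HasGoodReductionAtPrime p) (hK : IsImaginaryQuadratic K) {v vbar : HeightOneSpectrum (𝓞 K)}
    (hpv : ((p : ℕ) : 𝓞 K) ∈ v.asIdeal) (hvbar : ((p : ℕ) : 𝓞 K) ∈ vbar.asIdeal) (hne : vbar ≠ v)
    (Sf : Finset (HeightOneSpectrum (𝓞 K)))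
    (hSf : ∀ w : HeightOneSpectrum (𝓞 K), w ∈ Sf ↔
      (((W.conductorNorm ℤ : ℤ) : 𝓞 K) ∈ w.asIdeal ∧ ((p : ℕ) : 𝓞 K) ∉ w.asIdeal))
    (w : HeightOneSpectrum (𝓞 K)) :
    w ∈ insert v (insert vbar Sf) ↔ ((W.conductorNorm ℤ : ℤ) : 𝓞 K) ∈ w.asIdeal := by
  constructor
  · intro hw
    rw [Finset.mem_insert, Finset.mem_insert] at hw
    rcases hw with rfl | rfl | hw
    · exact conductorNorm_mem_of_natCast_mem_of_not_good W hbad hpv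
    · exact conductorNorm_mem_of_natCast_mem_of_not_good W hbad hvbar
    · exact ((hSf w).mp hw).1
  · intro hN
    by_cases hpw : ((p : ℕ) : 𝓞 K) ∈ w.asIdeal
    · have h := mem_insert_insert_of_natCast_mem hK hpv hvbar hne Sf w hpw
      rw [Finset.mem_coe] at h
      exact h
    · rw [Finset.mem_insert, Finset.mem_insert]
      exact Or.inr (Or.inr ((hSf w).mpr ⟨hN, hpw⟩))

end Bookkeeping

/-! ## §1. Road (A) at a BAD prime: `Σ_{w∈Sf} λ𝒫_w(θ) ≤ corank_{ℤ_p}(H¹_{𝓕_nr^{Sf}}/H¹_{𝓕_nr})` -/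

section RoadA

variable {K : Type} [Field K] [NumberField K] {p : ℕ} [hp : Fact p.Prime]

/-- **Keller–Yin Prop. 1.2.5 (eq:Gr to imp), `≥` direction, AT ANY BAD EISENSTEIN PRIME (`p ∣ N_W`), from the five Greenberg facts
BY NAME.** `W/ℚ` globally minimal, `2 < p` BAD (`p ∣ N_W`), `K` imaginary quadratic with (Heeg) for `N_W`, `v` through `ι`, `v̄ ∋ p`,
`v̄ ≠ v`, `κ` anticyclotomic with topological generator `γ`, `(θsub, θquot)` a residual pair of `E_K[p]`, `θ ∈ {θsub, θquot}`, `Sf` line b1's set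
(`w ∈ Sf ↔ (N_W ∈ w ∧ p ∉ w)`), and [RH] for `θ` (every PRIMITIVE dual datum of `H¹_{𝓕_nr}(K_∞, (F/𝒪)(θ))` f.g. `Λ`-torsion with `μ = 0`):
`Σ_{w∈Sf} charLocalLambda ∅ κ θ w ≤ corank_{ℤ_p}(H¹_{𝓕_nr^{Sf}}/H¹_{𝓕_nr})`. LEAD x1-p1 g2's road (A)
(`AcTwistDeformation.prop125_residualPair_unrSelmer_corank_ge_of_facts`) VERBATIM with the `N`-generic producers fed the prime-to-`p` part
`N' = N / p^{v_p(N)}` (still (Heeg)) and `θ`'s unramifiedness outside `S = Sf ∪ {v, v̄}` read from the places over `N` (§0).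
[cite: KellerYin2024, Prop. 1.2.5 (eq:Gr to imp), Rem. 1.2.3 (ii), §5.1 (arXiv:2402.12781v2 TeX L780–800, L690–712, L1725–1769)]
[cite: Greenberg2016Selmer, Prop. 2.6.3 (§2.6 p. 10)] [cite: Greenberg2006, Props. 3.2, 4.1, 4.2, §5 A] [cite: PollackWeston2011, App. A Prop. A.2] -/
theorem sum_charLocalLambda_le_zpCorank_unrSelmer_quotient_of_not_good (h263 : prop263_sur_of_crk)
    (h41 : prop41_globalEulerPoincareCorank) (h42 : prop42_localEulerPoincareCorank)
    (h5A : sec5A_localH2_subsingleton_of_LOC1) (h32 : prop32_cohomology_isCofinitelyGenerated)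
    (W : WeierstrassCurve ℚ) [W.IsElliptic] [W.IsGloballyMinimal] (hp : 2 < p)
    (hbad : ¬ W.HasGoodReductionAtPrime p) (hK : IsImaginaryQuadratic K)
    (hH : SatisfiesHeegnerHypothesis (W.conductorNorm ℤ) K)
    {ι : K →+* ℚ_[p]} {v vbar : HeightOneSpectrum (𝓞 K)} (hvι : ∀ x : 𝓞 K, x ∈ v.asIdeal ↔ ‖ι (x : K)‖ < 1)
    (hvbar : ((p : ℕ) : 𝓞 K) ∈ vbar.asIdeal) (hne : vbar ≠ v)
    (κ : ZpExtension K p) (hκ : κ.IsAnticyclotomic) (γ : absoluteGaloisGroup K) [Fact (κ.IsTopGenerator γ)]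
    {θsub θquot : FramedGaloisRep K (padicCoeffIntegers (∅ : Set (PadicAlgCl p))) 1}
    (hpair : IsResidualPairOver (W.baseChange K) p θsub θquot)
    (Sf : Finset (HeightOneSpectrum (𝓞 K)))
    (hSf : ∀ w : HeightOneSpectrum (𝓞 K), w ∈ Sf ↔
      (((W.conductorNorm ℤ : ℤ) : 𝓞 K) ∈ w.asIdeal ∧ ((p : ℕ) : 𝓞 K) ∉ w.asIdeal))
    (θ : FramedGaloisRep K (padicCoeffIntegers (∅ : Set (PadicAlgCl p))) 1) (hθ : θ = θsub ∨ θ = θquot)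
    (hRH : ∀ D : DatumDualData κ γ (charModule ∅ θ)
        (AcSelmer.bdpData (charModule ∅ θ) p vbar) (∅ : Set (HeightOneSpectrum (𝓞 K))),
      Module.Finite (IwasawaAlgebra p) D.X ∧ Module.IsTorsion (IwasawaAlgebra p) D.X ∧ muInvariant p D.X = 0) :
    ∑ w ∈ Sf, charLocalLambda ∅ κ θ w ≤
      zpCorank (↥(unrSelmer κ (charModule ∅ θ) vbar (↑Sf : Set (HeightOneSpectrum (𝓞 K)))) ⧸
        (unrSelmer κ (charModule ∅ θ) vbar (∅ : Set (HeightOneSpectrum (𝓞 K)))).addSubgroupOf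
          (unrSelmer κ (charModule ∅ θ) vbar (↑Sf : Set (HeightOneSpectrum (𝓞 K))))) p := by
  have hγ : κ.IsTopGenerator γ := Fact.out
  have hv : ((p : ℕ) : 𝓞 K) ∈ v.asIdeal := IwasawaTwoVariable.natCast_mem_asIdeal_of_norm_iff hvι
  -- the prime-to-`p` part of the conductor: line b1's `Sf` is the set of places over it
  have hN0 : W.conductorNorm ℤ ≠ 0 := (W.conductorNorm_pos_holds).ne'
  set N' : ℕ := W.conductorNorm ℤ / p ^ (W.conductorNorm ℤ).factorization p with hN'def
  have hH' : SatisfiesHeegnerHypothesis N' K := hH.of_dvd (Nat.ordCompl_dvd (W.conductorNorm ℤ) p)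
  have hSf' : ∀ w : HeightOneSpectrum (𝓞 K), w ∈ Sf ↔ ((N' : ℤ) : 𝓞 K) ∈ w.asIdeal := fun w ↦ by
    rw [hSf, hN'def, SplitMultCharImprimitiveShift.intCast_ordCompl_mem_iff hN0]
  have hSfp : ∀ w ∈ Sf, ((p : ℕ) : 𝓞 K) ∉ w.asIdeal := fun w hw ↦ ((hSf w).mp hw).2
  have hSp : ∀ w : HeightOneSpectrum (𝓞 K), ((p : ℕ) : 𝓞 K) ∈ w.asIdeal → w = v ∨ w = vbar :=
    fun w hw ↦ eq_or_eq_of_natCast_mem_of_ne hK.1 hv hvbar hne hw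
  have hθpow : ∀ σ : absoluteGaloisGroup K, θ σ ^ (p - 1) = 1 := fun σ ↦ by
    rcases hθ with rfl | rfl
    · exact (hpair.pow_sub_one σ).1
    · exact (hpair.pow_sub_one σ).2
  -- every `w ∈ Sf` is finitely decomposed in `K_∞^{ac}` (Brink), with `κ(D_w) = p^{a_w} ℤ_p` exactly
  have hdec : ∀ w ∈ Sf, ¬ decomp (K := K) w ≤ κ.kerSubgroup := fun w hw hle ↦ by
    obtain ⟨δ, hδ, hne1⟩ := exists_mem_decomp_apply_ne_one_of_heegner hK hp hH' κ hκ w ((hSf' w).mp hw)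
      (hSfp w hw)
    exact hne1 (ZpExtension.mem_kerSubgroup.mp (hle hδ))
  have hexp : ∀ w : HeightOneSpectrum (𝓞 K), ∃ a : ℕ, w ∈ Sf →
      (∃ δ ∈ decomp (K := K) w, (κ δ).toAdd = (p : ℤ_[p]) ^ a) ∧
        ∀ δ ∈ decomp (K := K) w, (p : ℤ_[p]) ^ a ∣ (κ δ).toAdd := by
    intro w
    by_cases hw : w ∈ Sf
    · obtain ⟨c, ⟨d₀, hd₀⟩, -, hdvd⟩ :=
        UniversalToricDescentSigmaLocalStabilizer.exists_pow_and_forall_dvd_of_not_le κ w (hdec w hw)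
      exact ⟨c, fun _ ↦ ⟨⟨d₀, d₀.2, hd₀⟩, fun δ hδ ↦ hdvd ⟨δ, hδ⟩⟩⟩
    · exact ⟨0, fun h ↦ (hw h).elim⟩
  choose a ha using hexp
  have hd₀ : ∀ w ∈ Sf, ∃ δ ∈ decomp (K := K) w, (κ δ).toAdd = (p : ℤ_[p]) ^ a w :=
    fun w hw ↦ (ha w hw).1
  have hdiv : ∀ w ∈ Sf, ∀ δ ∈ decomp (K := K) w, (p : ℤ_[p]) ^ a w ∣ (κ δ).toAdd :=
    fun w hw ↦ (ha w hw).2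
  -- the representatives `γ^i` of the places above `w`: `κ(γ^i) = i`
  have hσrep : ∀ w ∈ Sf, ∀ i : ℕ, i < p ^ a w → (κ ((fun (_ : HeightOneSpectrum (𝓞 K)) (i : ℕ) ↦ γ ^ i) w i)).toAdd =
      (i : ℤ_[p]) := fun w _ i _ ↦ by
    change (κ (γ ^ i)).toAdd = (i : ℤ_[p])
    rw [map_pow, show κ γ = Multiplicative.ofAdd 1 from hγ, ← ofAdd_nsmul, toAdd_ofAdd, nsmul_one]
  -- `S = {v, v̄} ∪ Sf` = the places over `N_W`; `θ` is unramified outside `S`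
  have hS : ∀ w : HeightOneSpectrum (𝓞 K), ((p : ℕ) : 𝓞 K) ∈ w.asIdeal →
      w ∈ (↑(insert v (insert vbar Sf)) : Set (HeightOneSpectrum (𝓞 K))) :=
    mem_insert_insert_of_natCast_mem hK hv hvbar hne Sf
  have hSfS : ∀ w ∈ Sf, w ∈ (↑(insert v (insert vbar Sf)) : Set (HeightOneSpectrum (𝓞 K))) :=
    fun w hw ↦ by
    rw [Finset.coe_insert, Finset.coe_insert]
    exact Or.inr (Or.inr (Finset.mem_coe.mpr hw))
  have hSN : ∀ w : HeightOneSpectrum (𝓞 K), w ∈ insert v (insert vbar Sf) ↔ ((W.conductorNorm ℤ : ℤ) : 𝓞 K) ∈ w.asIdeal :=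
    mem_insert_insert_iff_conductorNorm_mem_of_not_good W hbad hK hv hvbar hne Sf hSf
  have h : ramificationSubgroup K (↑(insert v (insert vbar Sf)) : Set (HeightOneSpectrum (𝓞 K))) ≤
      (unitChar θ).toMonoidHom.ker :=
    ramificationSubgroup_le_ker_unitChar_of_residualPair W hpair (insert v (insert vbar Sf)) hSN _ (fun _ hw ↦ hw) hS θ hθ
  -- the canonical (discrete) topological instances of the model
  letI tΛ : TopologicalSpace (PowerSeries ℤ_[p]) := ⊥
  haveI : DiscreteTopology (PowerSeries ℤ_[p]) := ⟨rfl⟩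
  haveI : IsTopologicalRing (PowerSeries ℤ_[p]) := inferInstance
  haveI hAdisc : DiscreteTopology (QpModZp p) := QpModZp.discreteTopology p
  haveI : IsTopologicalAddGroup (BigRepModule ℤ_[p] p (QpModZp p)) := inferInstance
  haveI : ContinuousSMul (PowerSeries ℤ_[p]) (BigRepModule ℤ_[p] p (QpModZp p)) := inferInstance
  -- the model `ρ_θ` on `ℚ_p/ℤ_p`, `ψ = (charModuleEquiv θ)⁻¹`, the Shapiro descent `F`, and [RH]
  have hψ := charModuleEquiv_symm_galois (↑(insert v (insert vbar Sf)) : Set (HeightOneSpectrum (𝓞 K))) θ h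
  obtain ⟨F, hF⟩ := exists_shapiroDescent _ hS κ (characterRepUnramified _ θ h) (charModuleEquiv θ).symm hψ
  obtain ⟨hSel, hSelfg⟩ := hasCorank_fullAtSelmer_zero_of_RH hK κ hγ hv hvbar hne θ _ hS h hRH
  -- the `K_∞`-side global-to-local surjectivity at the places of `Sf` (all off `p`)
  have h8 : ∀ y : ∀ w : HeightOneSpectrum (𝓞 K), ℕ →
      subgroupH1 (κ.kerSubgroup ⊓ decomp (K := K) w) (charModule (∅ : Set (PadicAlgCl p)) θ),
      ∃ u ∈ unrSelmer κ (charModule (∅ : Set (PadicAlgCl p)) θ) vbar (↑Sf : Set (HeightOneSpectrum (𝓞 K))),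
        ∀ w ∈ Sf, ∀ i : ℕ, i < p ^ a w →
          resOfLe (charModule (∅ : Set (PadicAlgCl p)) θ)
            (inf_le_left : κ.kerSubgroup ⊓ decomp (K := K) w ≤ κ.kerSubgroup)
            (conjH1 κ.kerSubgroup (charModule (∅ : Set (PadicAlgCl p)) θ) (γ ^ i) u) = y w i := fun y ↦
    exists_mem_unrSelmer_forall_resOfLe_conjH1_eq _ hS κ (characterRepUnramified _ θ h)
      (charModuleEquiv θ).symm hψ h263 h41 h42 h5A h32 (Finset.finite_toSet _) hK
      (LinearEquiv.refl ℤ_[p] (QpModZp p)) (characterRepUnramified_hscalar _ θ h)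
      (fun w hw ↦ exists_local_apply_ne_one_of_mem_insert_insert hK hp hH κ hκ hv hvbar (insert v (insert vbar Sf)) hSN w
        (by rw [Finset.coe_insert, Finset.coe_insert]; exact Or.inr (Or.inr hw)))
      hne hv hvbar hSp hSel hSelfg (fun b ↦ QpModZp.exists_pow_nsmul_eq_zero b) hF Sf hSfS hSfp a hdiv hd₀
      (fun _ i ↦ γ ^ i) hσrep y
  -- corank bookkeeping (x1-p1-w2's adapter, generic core)
  exact UnrSelmerLocSurjAdapter.sum_charLocalLambda_le_zpCorank_unrSelmer_quotient_of_forall_exists κ θ vbar Sf hθpow hγ hSfp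
    (fun w hw ↦ exists_mem_decomp_apply_ne_one_of_heegner hK hp hH' κ hκ w ((hSf' w).mp hw) (hSfp w hw)) a hdiv hd₀
    (fun _ i ↦ γ ^ i) hσrep h8

end RoadA

/-! ## §2. The Prop. 1.2.5 package at a BAD prime -/

section Package

variable {K : Type} [Field K] [NumberField K] {p : ℕ} [hp : Fact p.Prime]

/-- **Keller–Yin / CGLS Prop. 1.2.5 for the residual characters AT ANY BAD EISENSTEIN PRIME (`p ∣ N_W`), in the kernel modulo Greenberg's five
facts BY NAME.** Same binders as `sum_charLocalLambda_le_zpCorank_unrSelmer_quotient_of_not_good`; conclusion: for EVERY imprimitive unramified dual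
datum `DS` over line b1's `Sf` and every primitive one `D`: `DS.X` is f.g. `Λ`-torsion with `μ = 0` and `λ(DS.X) = λ(D.X) + Σ_{w∈Sf} λ𝒫_w(θ)`.
Assembly: §1 (`≥`) + `UnrSelmerQuotientCorankLocalLambda.zpCorank_unrSelmer_quotient_le_at_residualPair` (`≤`, at `N'`) + the finiteness of
`(H¹_{𝓕_nr^{Sf}}/H¹_{𝓕_nr})[p]` (`UnrSelmerQuotientTorsionFiniteChar.finite_torsionBy_unrSelmer_quotient`, at `N'`) + Greenberg–Vatsal Cor. (2.3)
for the character module (`UnrSelmerImprimitiveFiniteness.moduleFinite_isTorsion_mu_lambda_of_primitive`).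
[cite: KellerYin2024, Prop. 1.2.5 and proof (arXiv:2402.12781v2 TeX L780–800)] [cite: CastellaGrossiLeeSkinner2022, Prop. 1.2.5 and proof]
[cite: GreenbergVatsal2000, §2 Cor. (2.3) (pp. 20–21)] [cite: Greenberg2016Selmer, Prop. 2.6.3] [cite: Greenberg2006, Props. 3.2, 4.1, 4.2, §5 A] -/
theorem imprimitive_clauses_of_not_good (h263 : prop263_sur_of_crk)
    (h41 : prop41_globalEulerPoincareCorank) (h42 : prop42_localEulerPoincareCorank)
    (h5A : sec5A_localH2_subsingleton_of_LOC1) (h32 : prop32_cohomology_isCofinitelyGenerated)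
    (W : WeierstrassCurve ℚ) [W.IsElliptic] [W.IsGloballyMinimal] (hp : 2 < p)
    (hbad : ¬ W.HasGoodReductionAtPrime p) (hK : IsImaginaryQuadratic K)
    (hH : SatisfiesHeegnerHypothesis (W.conductorNorm ℤ) K)
    {ι : K →+* ℚ_[p]} {v vbar : HeightOneSpectrum (𝓞 K)} (hvι : ∀ x : 𝓞 K, x ∈ v.asIdeal ↔ ‖ι (x : K)‖ < 1)
    (hvbar : ((p : ℕ) : 𝓞 K) ∈ vbar.asIdeal) (hne : vbar ≠ v)
    (κ : ZpExtension K p) (hκ : κ.IsAnticyclotomic) (γ : absoluteGaloisGroup K) [Fact (κ.IsTopGenerator γ)]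
    {θsub θquot : FramedGaloisRep K (padicCoeffIntegers (∅ : Set (PadicAlgCl p))) 1}
    (hpair : IsResidualPairOver (W.baseChange K) p θsub θquot)
    (Sf : Finset (HeightOneSpectrum (𝓞 K)))
    (hSf : ∀ w : HeightOneSpectrum (𝓞 K), w ∈ Sf ↔
      (((W.conductorNorm ℤ : ℤ) : 𝓞 K) ∈ w.asIdeal ∧ ((p : ℕ) : 𝓞 K) ∉ w.asIdeal))
    (θ : FramedGaloisRep K (padicCoeffIntegers (∅ : Set (PadicAlgCl p))) 1) (hθ : θ = θsub ∨ θ = θquot)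
    (hRH : ∀ D : DatumDualData κ γ (charModule ∅ θ)
        (AcSelmer.bdpData (charModule ∅ θ) p vbar) (∅ : Set (HeightOneSpectrum (𝓞 K))),
      Module.Finite (IwasawaAlgebra p) D.X ∧ Module.IsTorsion (IwasawaAlgebra p) D.X ∧ muInvariant p D.X = 0)
    (D : DatumDualData κ γ (charModule ∅ θ) (AcSelmer.bdpData (charModule ∅ θ) p vbar) (∅ : Set (HeightOneSpectrum (𝓞 K))))
    (DS : DatumDualData κ γ (charModule ∅ θ) (AcSelmer.bdpData (charModule ∅ θ) p vbar) (↑Sf : Set (HeightOneSpectrum (𝓞 K)))) :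
    Module.Finite (IwasawaAlgebra p) DS.X ∧ Module.IsTorsion (IwasawaAlgebra p) DS.X ∧ muInvariant p DS.X = 0 ∧
      lambdaInvariant p DS.X = lambdaInvariant p D.X + ∑ w ∈ Sf, charLocalLambda ∅ κ θ w := by
  have hγ : κ.IsTopGenerator γ := Fact.out
  have hN0 : W.conductorNorm ℤ ≠ 0 := (W.conductorNorm_pos_holds).ne'
  set N' : ℕ := W.conductorNorm ℤ / p ^ (W.conductorNorm ℤ).factorization p with hN'def
  have hH' : SatisfiesHeegnerHypothesis N' K := hH.of_dvd (Nat.ordCompl_dvd (W.conductorNorm ℤ) p)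
  have hSf' : ∀ w : HeightOneSpectrum (𝓞 K), w ∈ Sf ↔ ((N' : ℤ) : 𝓞 K) ∈ w.asIdeal := fun w ↦ by
    rw [hSf, hN'def, SplitMultCharImprimitiveShift.intCast_ordCompl_mem_iff hN0]
  have hSfp : ∀ w ∈ Sf, ((p : ℕ) : 𝓞 K) ∉ w.asIdeal := fun w hw ↦ ((hSf w).mp hw).2
  -- the corank IDENTITY of the quotient
  have hge := sum_charLocalLambda_le_zpCorank_unrSelmer_quotient_of_not_good h263 h41 h42 h5A h32 W hp hbad hK hH hvι hvbar hne κ hκ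
    γ hpair Sf hSf θ hθ hRH
  have hle := UnrSelmerQuotientCorankLocalLambda.zpCorank_unrSelmer_quotient_le_at_residualPair hK hp hH' κ hκ hγ vbar θsub θquot
    hpair Sf hSf' hSfp θ hθ
  have hcork := le_antisymm hle hge
  -- finiteness of the `p`-torsion of the quotient, and GV Cor. (2.3)
  have hQ := UnrSelmerQuotientTorsionFiniteChar.finite_torsionBy_unrSelmer_quotient hK hp hH' κ hκ hγ vbar θ Sf hSf'
  obtain ⟨hfg, htors, hμ⟩ := hRH D
  haveI := hfg
  obtain ⟨hfgS, htorsS, hμS, hlamS⟩ :=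
    UnrSelmerImprimitiveFiniteness.moduleFinite_isTorsion_mu_lambda_of_primitive κ vbar
      (exists_pow_smul_cofree_eq_zero (∅ : Set (PadicAlgCl p)) θ)
      (isOpen_stabilizer_cofree (∅ : Set (PadicAlgCl p)) θ) hγ
      (Set.empty_subset (↑Sf : Set (HeightOneSpectrum (𝓞 K)))) D htors DS hQ
  exact ⟨hfgS, htorsS, hμS.trans hμ, by rw [hlamS, hcork]⟩

end Package

end Summit.BirchSwinnertonDyer.BirchSwinnertonDyer.Theorems.SchneiderFreeAdditiveX3.BadPrimeCharImprimitiveShift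

end
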